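import Literature.MathematicalPhysics.QuantumManyBody.OnsagerInequality
import HarnessLib

/-!
# Point charges and background in a kernel of positive type (the mechanism of the sliding lemma)

Topic `Literature/MathematicalPhysics/QuantumManyBody` (electrostatics groundwork for the charged
Bose gas, `JelliumBoseGas.foldyLaw`). The sliding localization of the Coulomb interaction
[ConlonLiebYau1988, Lemma 2.1; LiebSolovej2001, Lemma 3.1; LSSY2005, Thm. 10.5/12.4] rests on one
mechanism: if a real even kernel `F` on `ℝ³` has a NONNEGATIVE Fourier transform and a finite
value at the origin, then for unit point charges `x₁, …, x_N` and a background density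
`∑_{i<j} F(xᵢ - xⱼ) - ∑ᵢ ∫ g F(xᵢ - ·) + ½∬ g g F ≥ -½ N F(0)` — "the Fourier transform of the
function `F(x) = |x|⁻¹ - h(x)Y_{ω(t)}(x)` is non-negative … Note, moreover, that
`lim_{x→0} F(x) = ω(t)`. Hence `∑_{i<j} F(yᵢ - yⱼ) - ρ∑ⱼ∫F(yⱼ - y)dy + ½ρ²∬F(x - y)dxdy ≥ -Nω(t)/2`"
[LiebSolovej2001, proof of Lemma 3.1]. This file proves the mechanism for kernels presented as

`F(z) = ∫ Φ(p) cos(2π⟨p, z⟩) dp`, `Φ ≥ 0`, `Φ ∈ L¹(ℝ³)` (so `F = Re 𝓕⁻¹Φ`, `F(0) = ∫ Φ`),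

with real charges `cᵢ` and a real background `g ∈ L¹(ℝ³)`:

**`0 ≤ ∑ᵢ∑ⱼ cᵢcⱼ F(xᵢ - xⱼ) - 2∑ᵢ cᵢ ∫ g(y)F(xᵢ - y)dy + ∬ g(x)g(y)F(x - y)`**
`= ∫ Φ(p) |∑ᵢ cᵢ e^{2πi⟨p,xᵢ⟩} - ĝ(p)|² dp`, hence
**`∑_{i<j} cᵢcⱼ F(xᵢ - xⱼ) - ∑ᵢ cᵢ ∫ g F(xᵢ - ·) + ½∬ g g F ≥ -½ F(0) ∑ᵢ cᵢ²`.**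

Everything is done with real `cos`/`sin` (`|∑cᵢe^{iθᵢ} - (A + iB)|² = (∑cᵢcos θᵢ - A)² +
(∑cᵢ sin θᵢ - B)²`) and Fubini on absolutely convergent integrals. The positivity of the Fourier
transform of `|x|⁻¹ - h Y_ω` ([ConlonLiebYau1988, Lemma 2.1]) is the analytic input NOT proved here.

* `Coulomb.sq_sum_cos_sub_add_sq_sum_sin_sub` — the algebraic square identity.
* `Coulomb.positiveType_points_nonneg` — the first display.
* `Coulomb.positiveType_points_ge` — the second display.

## References

* [LiebSolovej2001] E. H. Lieb, J. P. Solovej, Commun. Math. Phys. 217 (2001) 127–163, Lemma 3.1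
  and its proof (arXiv:cond-mat/0007425, p. 8).
* [ConlonLiebYau1988] J. G. Conlon, E. H. Lieb, H.-T. Yau, Commun. Math. Phys. 116 (1988) 417–448,
  Lemma 2.1.
* [LSSY2005] Thm. 10.5 (arXiv Thm. 12.4, "Controlling interactions by sliding").
-/

noncomputable section

open MeasureTheory Set Filter Real
open scoped ENNReal NNReal Topology InnerProductSpace

namespace Literature.MathematicalPhysics.QuantumManyBody.Coulomb

open BoseGas

/-! ### The square identity -/

/-- `(∑ᵢ cᵢ cos aᵢ - A)² + (∑ᵢ cᵢ sin aᵢ - B)²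
 = ∑ᵢ∑ⱼ cᵢcⱼ cos(aᵢ - aⱼ) - 2∑ᵢ cᵢ (cos aᵢ · A + sin aᵢ · B) + (A² + B²)`. [folklore] -/
theorem sq_sum_cos_sub_add_sq_sum_sin_sub {N : ℕ} (c a : Fin N → ℝ) (A B : ℝ) :
    (∑ i, c i * Real.cos (a i) - A) ^ 2 + (∑ i, c i * Real.sin (a i) - B) ^ 2 =
      (∑ i, ∑ j, c i * c j * Real.cos (a i - a j)) -
        2 * (∑ i, c i * (Real.cos (a i) * A + Real.sin (a i) * B)) + (A ^ 2 + B ^ 2) := by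
  have h1 : (∑ i, c i * Real.cos (a i)) ^ 2 + (∑ i, c i * Real.sin (a i)) ^ 2 =
      ∑ i, ∑ j, c i * c j * Real.cos (a i - a j) := by
    rw [sq, sq, Finset.sum_mul_sum, Finset.sum_mul_sum, ← Finset.sum_add_distrib]
    refine Finset.sum_congr rfl fun i _ => ?_
    rw [← Finset.sum_add_distrib]
    refine Finset.sum_congr rfl fun j _ => ?_
    rw [Real.cos_sub]
    ring
  have h2 : (∑ i, c i * Real.cos (a i)) * A + (∑ i, c i * Real.sin (a i)) * B =
      ∑ i, c i * (Real.cos (a i) * A + Real.sin (a i) * B) := by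
    rw [Finset.sum_mul, Finset.sum_mul, ← Finset.sum_add_distrib]
    refine Finset.sum_congr rfl fun i _ => ?_
    ring
  nlinarith [h1, h2]

/-! ### Integrability helpers -/

/-- `y ↦ g(y) cos(2π⟨p, z - y⟩)` and `y ↦ g(y) sin(2π⟨p, y⟩)`-type functions are integrable for
`g ∈ L¹`. [folklore] -/
theorem integrable_mul_cos {g : Space → ℝ} (hg : Integrable g) (φ : Space → ℝ)
    (hφ : Continuous φ) : Integrable fun y : Space => g y * Real.cos (φ y) := by
  refine hg.mul_bdd (c := 1) (Real.continuous_cos.comp hφ).aestronglyMeasurable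
    (Eventually.of_forall fun y => ?_)
  rw [Real.norm_eq_abs]
  exact Real.abs_cos_le_one _

/-- Sine version of `integrable_mul_cos`. [folklore] -/
theorem integrable_mul_sin {g : Space → ℝ} (hg : Integrable g) (φ : Space → ℝ)
    (hφ : Continuous φ) : Integrable fun y : Space => g y * Real.sin (φ y) := by
  refine hg.mul_bdd (c := 1) (Real.continuous_sin.comp hφ).aestronglyMeasurable
    (Eventually.of_forall fun y => ?_)
  rw [Real.norm_eq_abs]
  exact Real.abs_sin_le_one _

/-- The phase `(p, y) ↦ 2π⟨p, y⟩` is continuous. [folklore] -/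
theorem continuous_phase : Continuous fun q : Space × Space => 2 * π * ⟪q.1, q.2⟫_ℝ :=
  continuous_const.mul (continuous_inner)

/-! ### The mechanism -/

/-- **Point charges and background in a kernel of positive type** [LiebSolovej2001, proof of
Lemma 3.1, mechanism]: let `Φ ≥ 0` be measurable and integrable on `ℝ³` and
`F(z) = ∫ Φ(p) cos(2π⟨p, z⟩) dp` (`= Re 𝓕⁻¹Φ (z)`, a real even kernel of positive type). Then
for charges `cᵢ ∈ ℝ` at points `xᵢ ∈ ℝ³` and a real measurable background `g ∈ L¹(ℝ³)`,
`0 ≤ ∑ᵢ∑ⱼ cᵢcⱼ F(xᵢ - xⱼ) - 2∑ᵢ cᵢ ∫ g(y) F(xᵢ - y) dy + ∬ g(x) g(y) F(x - y) dx dy`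
(`= ∫ Φ(p) |∑ᵢ cᵢ e^{2πi⟨p,xᵢ⟩} - ĝ(p)|² dp`, computed with `cos`/`sin` and Fubini).
[cite: LiebSolovej2001, Lemma 3.1 (proof)] -/
theorem positiveType_points_nonneg {Φ : Space → ℝ} (hΦm : Measurable Φ) (hΦi : Integrable Φ)
    (hΦ0 : ∀ p, 0 ≤ Φ p) {N : ℕ} (c : Fin N → ℝ) (X : Fin N → Space) {g : Space → ℝ}
    (hgm : Measurable g) (hg : Integrable g) :
    0 ≤ (∑ i, ∑ j, c i * c j * ∫ p, Φ p * Real.cos (2 * π * ⟪p, X i - X j⟫_ℝ)) -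
        2 * (∑ i, c i * ∫ y, g y * ∫ p, Φ p * Real.cos (2 * π * ⟪p, X i - y⟫_ℝ)) +
        ∫ z : Space × Space, g z.1 * g z.2 * (∫ p, Φ p * Real.cos (2 * π * ⟪p, z.1 - z.2⟫_ℝ))
          ∂(volume.prod volume) := by
  -- notation for the `p`-dependent pieces
  set Sc : Space → ℝ := fun p => ∑ i, c i * Real.cos (2 * π * ⟪p, X i⟫_ℝ) with hSc
  set Ss : Space → ℝ := fun p => ∑ i, c i * Real.sin (2 * π * ⟪p, X i⟫_ℝ) with hSs
  set A : Space → ℝ := fun p => ∫ y, g y * Real.cos (2 * π * ⟪p, y⟫_ℝ) with hA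
  set B : Space → ℝ := fun p => ∫ y, g y * Real.sin (2 * π * ⟪p, y⟫_ℝ) with hB
  -- continuity of the phases in `p`
  have hph : ∀ z : Space, Continuous fun p : Space => 2 * π * ⟪p, z⟫_ℝ := fun z =>
    continuous_const.mul (continuous_inner.comp (continuous_id.prodMk continuous_const))
  have hphy : ∀ p : Space, Continuous fun y : Space => 2 * π * ⟪p, y⟫_ℝ := fun p =>
    continuous_const.mul (continuous_inner.comp (continuous_const.prodMk continuous_id))
  -- Step 1: the pointwise square identity in the form we integrate
  have hsq : ∀ p : Space, (Sc p - A p) ^ 2 + (Ss p - B p) ^ 2 =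
      (∑ i, ∑ j, c i * c j * Real.cos (2 * π * ⟪p, X i - X j⟫_ℝ)) -
        2 * (∑ i, c i * ∫ y, g y * Real.cos (2 * π * ⟪p, X i - y⟫_ℝ)) +
        ∫ z : Space × Space, g z.1 * g z.2 * Real.cos (2 * π * ⟪p, z.1 - z.2⟫_ℝ)
          ∂(volume.prod volume) := by
    intro p
    have e := sq_sum_cos_sub_add_sq_sum_sin_sub c (fun i => 2 * π * ⟪p, X i⟫_ℝ) (A p) (B p)
    simp only [hSc, hSs]
    rw [e]
    -- the three groups of terms
    have e1 : ∀ i j : Fin N, Real.cos (2 * π * ⟪p, X i⟫_ℝ - 2 * π * ⟪p, X j⟫_ℝ) =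
        Real.cos (2 * π * ⟪p, X i - X j⟫_ℝ) := by
      intro i j
      rw [inner_sub_right]
      ring_nf
    have e2 : ∀ i : Fin N, Real.cos (2 * π * ⟪p, X i⟫_ℝ) * A p + Real.sin (2 * π * ⟪p, X i⟫_ℝ) * B p =
        ∫ y, g y * Real.cos (2 * π * ⟪p, X i - y⟫_ℝ) := by
      intro i
      simp only [hA, hB]
      rw [← integral_const_mul, ← integral_const_mul,
        ← integral_add ((integrable_mul_cos hg _ (hphy p)).const_mul _)
          ((integrable_mul_sin hg _ (hphy p)).const_mul _)]
      refine integral_congr_ae (Eventually.of_forall fun y => ?_)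
      simp only
      rw [inner_sub_right, mul_sub, Real.cos_sub]
      ring
    have e3 : A p ^ 2 + B p ^ 2 =
        ∫ z : Space × Space, g z.1 * g z.2 * Real.cos (2 * π * ⟪p, z.1 - z.2⟫_ℝ) ∂(volume.prod volume) := by
      simp only [hA, hB]
      rw [sq, sq, ← integral_prod_mul, ← integral_prod_mul, ← integral_add]
      · refine integral_congr_ae (Eventually.of_forall fun z => ?_)
        simp only
        rw [inner_sub_right, mul_sub, Real.cos_sub]
        ring
      · exact (integrable_mul_cos hg _ (hphy p)).mul_prod (integrable_mul_cos hg _ (hphy p))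
      · exact (integrable_mul_sin hg _ (hphy p)).mul_prod (integrable_mul_sin hg _ (hphy p))
    simp_rw [e1, e2]
    rw [e3]
  -- Step 2: the cloud–cloud terms
  have hI1 : ∀ i j : Fin N, Integrable fun p : Space =>
      Φ p * Real.cos (2 * π * ⟪p, X i - X j⟫_ℝ) := fun i j => integrable_mul_cos hΦi _ (hph _)
  have he1 : (fun p : Space => Φ p * ∑ i, ∑ j, c i * c j * Real.cos (2 * π * ⟪p, X i - X j⟫_ℝ)) =
      fun p => ∑ i, ∑ j, c i * c j * (Φ p * Real.cos (2 * π * ⟪p, X i - X j⟫_ℝ)) := by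
    funext p
    rw [Finset.mul_sum]
    refine Finset.sum_congr rfl fun i _ => ?_
    rw [Finset.mul_sum]
    refine Finset.sum_congr rfl fun j _ => ?_
    ring
  have h1 : ∫ p : Space, Φ p * ∑ i, ∑ j, c i * c j * Real.cos (2 * π * ⟪p, X i - X j⟫_ℝ) =
      ∑ i, ∑ j, c i * c j * ∫ p, Φ p * Real.cos (2 * π * ⟪p, X i - X j⟫_ℝ) := by
    rw [he1, integral_finsetSum _ (fun i _ => integrable_finsetSum _ fun j _ => (hI1 i j).const_mul _)]
    refine Finset.sum_congr rfl fun i _ => ?_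
    rw [integral_finsetSum _ (fun j _ => (hI1 i j).const_mul _)]
    refine Finset.sum_congr rfl fun j _ => ?_
    exact integral_const_mul _ _
  have h1i : Integrable (fun p : Space => Φ p * ∑ i, ∑ j, c i * c j * Real.cos (2 * π * ⟪p, X i - X j⟫_ℝ)) := by
    rw [he1]
    exact integrable_finsetSum _ fun i _ => integrable_finsetSum _ fun j _ => (hI1 i j).const_mul _
  -- Step 3: the cloud–background terms, Fubini in `(p, y)`
  have hF2 : ∀ a : Space, Integrable (Function.uncurry fun (p : Space) (y : Space) =>
      Φ p * (g y * Real.cos (2 * π * ⟪p, a - y⟫_ℝ))) (volume.prod volume) := by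
    intro a
    have hm : Measurable (Function.uncurry fun (p : Space) (y : Space) =>
        Φ p * (g y * Real.cos (2 * π * ⟪p, a - y⟫_ℝ))) :=
      (hΦm.comp measurable_fst).mul ((hgm.comp measurable_snd).mul
        (Real.continuous_cos.measurable.comp ((continuous_const.mul (continuous_inner.comp
          (continuous_fst.prodMk (continuous_const.sub continuous_snd)))).measurable)))
    refine (hΦi.mul_prod hg.norm).mono' hm.aestronglyMeasurable (Eventually.of_forall fun q => ?_)
    show ‖Φ q.1 * (g q.2 * Real.cos (2 * π * ⟪q.1, a - q.2⟫_ℝ))‖ ≤ Φ q.1 * ‖g q.2‖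
    rw [norm_mul, norm_mul, Real.norm_of_nonneg (hΦ0 _)]
    refine mul_le_mul_of_nonneg_left ?_ (hΦ0 _)
    calc ‖g q.2‖ * ‖Real.cos (2 * π * ⟪q.1, a - q.2⟫_ℝ)‖ ≤ ‖g q.2‖ * 1 :=
          mul_le_mul_of_nonneg_left (by rw [Real.norm_eq_abs]; exact Real.abs_cos_le_one _) (norm_nonneg _)
      _ = ‖g q.2‖ := mul_one _
  have h2 : ∀ a : Space, ∫ p : Space, Φ p * ∫ y, g y * Real.cos (2 * π * ⟪p, a - y⟫_ℝ) =
      ∫ y, g y * ∫ p, Φ p * Real.cos (2 * π * ⟪p, a - y⟫_ℝ) := by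
    intro a
    have e1 : ∫ p : Space, Φ p * ∫ y, g y * Real.cos (2 * π * ⟪p, a - y⟫_ℝ) =
        ∫ p : Space, ∫ y, Φ p * (g y * Real.cos (2 * π * ⟪p, a - y⟫_ℝ)) := by
      refine integral_congr_ae (Eventually.of_forall fun p => ?_)
      exact (integral_const_mul _ _).symm
    rw [e1, integral_integral_swap (hF2 a)]
    refine integral_congr_ae (Eventually.of_forall fun y => ?_)
    show ∫ p : Space, Φ p * (g y * Real.cos (2 * π * ⟪p, a - y⟫_ℝ)) =
      g y * ∫ p, Φ p * Real.cos (2 * π * ⟪p, a - y⟫_ℝ)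
    rw [← integral_const_mul]
    refine integral_congr_ae (Eventually.of_forall fun p => ?_)
    ring
  have h2i : ∀ a : Space, Integrable (fun p : Space => Φ p * ∫ y, g y * Real.cos (2 * π * ⟪p, a - y⟫_ℝ)) := by
    intro a
    refine (hF2 a).integral_prod_left.congr (Eventually.of_forall fun p => ?_)
    show ∫ y, Φ p * (g y * Real.cos (2 * π * ⟪p, a - y⟫_ℝ)) = Φ p * ∫ y, g y * Real.cos (2 * π * ⟪p, a - y⟫_ℝ)
    exact integral_const_mul _ _
  have he2 : (fun p : Space => Φ p * ∑ i, c i * ∫ y, g y * Real.cos (2 * π * ⟪p, X i - y⟫_ℝ)) =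
      fun p => ∑ i, c i * (Φ p * ∫ y, g y * Real.cos (2 * π * ⟪p, X i - y⟫_ℝ)) := by
    funext p
    rw [Finset.mul_sum]
    refine Finset.sum_congr rfl fun i _ => ?_
    ring
  have h2s : ∫ p : Space, Φ p * ∑ i, c i * ∫ y, g y * Real.cos (2 * π * ⟪p, X i - y⟫_ℝ) =
      ∑ i, c i * ∫ y, g y * ∫ p, Φ p * Real.cos (2 * π * ⟪p, X i - y⟫_ℝ) := by
    rw [he2, integral_finsetSum _ (fun i _ => (h2i _).const_mul _)]
    refine Finset.sum_congr rfl fun i _ => ?_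
    rw [integral_const_mul, h2 (X i)]
  have h2si : Integrable (fun p : Space => Φ p * ∑ i, c i * ∫ y, g y * Real.cos (2 * π * ⟪p, X i - y⟫_ℝ)) := by
    rw [he2]
    exact integrable_finsetSum _ fun i _ => (h2i _).const_mul _
  -- Step 4: the background–background term, Fubini in `(p, (x, y))`
  have hF3 : Integrable (Function.uncurry fun (p : Space) (z : Space × Space) =>
      Φ p * (g z.1 * g z.2 * Real.cos (2 * π * ⟪p, z.1 - z.2⟫_ℝ)))
      (volume.prod (volume.prod volume)) := by
    have hm : Measurable (Function.uncurry fun (p : Space) (z : Space × Space) =>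
        Φ p * (g z.1 * g z.2 * Real.cos (2 * π * ⟪p, z.1 - z.2⟫_ℝ))) :=
      (hΦm.comp measurable_fst).mul (((hgm.comp (measurable_fst.comp measurable_snd)).mul
        (hgm.comp (measurable_snd.comp measurable_snd))).mul
        (Real.continuous_cos.measurable.comp ((continuous_const.mul (continuous_inner.comp
          (continuous_fst.prodMk ((continuous_fst.comp continuous_snd).sub
            (continuous_snd.comp continuous_snd))))).measurable)))
    refine (hΦi.mul_prod (hg.norm.mul_prod hg.norm)).mono' hm.aestronglyMeasurable
      (Eventually.of_forall fun q => ?_)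
    show ‖Φ q.1 * (g q.2.1 * g q.2.2 * Real.cos (2 * π * ⟪q.1, q.2.1 - q.2.2⟫_ℝ))‖ ≤
      Φ q.1 * (‖g q.2.1‖ * ‖g q.2.2‖)
    rw [norm_mul, norm_mul, norm_mul, Real.norm_of_nonneg (hΦ0 _)]
    refine mul_le_mul_of_nonneg_left ?_ (hΦ0 _)
    calc ‖g q.2.1‖ * ‖g q.2.2‖ * ‖Real.cos (2 * π * ⟪q.1, q.2.1 - q.2.2⟫_ℝ)‖
        ≤ ‖g q.2.1‖ * ‖g q.2.2‖ * 1 :=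
          mul_le_mul_of_nonneg_left (by rw [Real.norm_eq_abs]; exact Real.abs_cos_le_one _)
            (by positivity)
      _ = ‖g q.2.1‖ * ‖g q.2.2‖ := mul_one _
  have h3 : ∫ p : Space, Φ p * ∫ z : Space × Space, g z.1 * g z.2 * Real.cos (2 * π * ⟪p, z.1 - z.2⟫_ℝ)
        ∂(volume.prod volume) =
      ∫ z : Space × Space, g z.1 * g z.2 * (∫ p, Φ p * Real.cos (2 * π * ⟪p, z.1 - z.2⟫_ℝ))
        ∂(volume.prod volume) := by
    have e1 : ∫ p : Space, Φ p * ∫ z : Space × Space, g z.1 * g z.2 *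
          Real.cos (2 * π * ⟪p, z.1 - z.2⟫_ℝ) ∂(volume.prod volume) =
        ∫ p : Space, ∫ z : Space × Space, Φ p * (g z.1 * g z.2 *
          Real.cos (2 * π * ⟪p, z.1 - z.2⟫_ℝ)) ∂(volume.prod volume) := by
      refine integral_congr_ae (Eventually.of_forall fun p => ?_)
      exact (integral_const_mul _ _).symm
    rw [e1, integral_integral_swap hF3]
    refine integral_congr_ae (Eventually.of_forall fun z => ?_)
    show ∫ p : Space, Φ p * (g z.1 * g z.2 * Real.cos (2 * π * ⟪p, z.1 - z.2⟫_ℝ)) =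
      g z.1 * g z.2 * ∫ p, Φ p * Real.cos (2 * π * ⟪p, z.1 - z.2⟫_ℝ)
    rw [← integral_const_mul]
    refine integral_congr_ae (Eventually.of_forall fun p => ?_)
    ring
  have h3i : Integrable (fun p : Space => Φ p * ∫ z : Space × Space, g z.1 * g z.2 *
      Real.cos (2 * π * ⟪p, z.1 - z.2⟫_ℝ) ∂(volume.prod volume)) := by
    refine hF3.integral_prod_left.congr (Eventually.of_forall fun p => ?_)
    show ∫ z : Space × Space, Φ p * (g z.1 * g z.2 * Real.cos (2 * π * ⟪p, z.1 - z.2⟫_ℝ))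
        ∂(volume.prod volume) =
      Φ p * ∫ z : Space × Space, g z.1 * g z.2 * Real.cos (2 * π * ⟪p, z.1 - z.2⟫_ℝ) ∂(volume.prod volume)
    exact integral_const_mul _ _
  -- Step 5: assemble `0 ≤ ∫ Φ ((Sc - A)² + (Ss - B)²)`
  have hQ : 0 ≤ ∫ p : Space, Φ p * ((Sc p - A p) ^ 2 + (Ss p - B p) ^ 2) :=
    integral_nonneg fun p => mul_nonneg (hΦ0 p) (by positivity)
  have he : (fun p : Space => Φ p * ((Sc p - A p) ^ 2 + (Ss p - B p) ^ 2)) =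
      fun p => (Φ p * ∑ i, ∑ j, c i * c j * Real.cos (2 * π * ⟪p, X i - X j⟫_ℝ) -
        2 * (Φ p * ∑ i, c i * ∫ y, g y * Real.cos (2 * π * ⟪p, X i - y⟫_ℝ))) +
        Φ p * ∫ z : Space × Space, g z.1 * g z.2 * Real.cos (2 * π * ⟪p, z.1 - z.2⟫_ℝ)
          ∂(volume.prod volume) := by
    funext p
    rw [hsq p]
    ring
  have hI2 : Integrable (fun p : Space => 2 * (Φ p * ∑ i, c i * ∫ y, g y *
      Real.cos (2 * π * ⟪p, X i - y⟫_ℝ))) := h2si.const_mul 2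
  have hI12 : Integrable (fun p : Space => Φ p * ∑ i, ∑ j, c i * c j * Real.cos (2 * π * ⟪p, X i - X j⟫_ℝ) -
      2 * (Φ p * ∑ i, c i * ∫ y, g y * Real.cos (2 * π * ⟪p, X i - y⟫_ℝ))) := h1i.sub hI2
  have eA : ∫ p : Space, (Φ p * ∑ i, ∑ j, c i * c j * Real.cos (2 * π * ⟪p, X i - X j⟫_ℝ) -
      2 * (Φ p * ∑ i, c i * ∫ y, g y * Real.cos (2 * π * ⟪p, X i - y⟫_ℝ)) +
      Φ p * ∫ z : Space × Space, g z.1 * g z.2 * Real.cos (2 * π * ⟪p, z.1 - z.2⟫_ℝ)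
        ∂(volume.prod volume)) =
      (∫ p : Space, (Φ p * ∑ i, ∑ j, c i * c j * Real.cos (2 * π * ⟪p, X i - X j⟫_ℝ) -
        2 * (Φ p * ∑ i, c i * ∫ y, g y * Real.cos (2 * π * ⟪p, X i - y⟫_ℝ)))) +
      ∫ p : Space, Φ p * ∫ z : Space × Space, g z.1 * g z.2 * Real.cos (2 * π * ⟪p, z.1 - z.2⟫_ℝ)
        ∂(volume.prod volume) := integral_add hI12 h3i
  have eB : ∫ p : Space, (Φ p * ∑ i, ∑ j, c i * c j * Real.cos (2 * π * ⟪p, X i - X j⟫_ℝ) -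
      2 * (Φ p * ∑ i, c i * ∫ y, g y * Real.cos (2 * π * ⟪p, X i - y⟫_ℝ))) =
      (∫ p : Space, Φ p * ∑ i, ∑ j, c i * c j * Real.cos (2 * π * ⟪p, X i - X j⟫_ℝ)) -
      ∫ p : Space, 2 * (Φ p * ∑ i, c i * ∫ y, g y * Real.cos (2 * π * ⟪p, X i - y⟫_ℝ)) :=
    integral_sub h1i hI2
  have eC : ∫ p : Space, 2 * (Φ p * ∑ i, c i * ∫ y, g y * Real.cos (2 * π * ⟪p, X i - y⟫_ℝ)) =
      2 * ∫ p : Space, Φ p * ∑ i, c i * ∫ y, g y * Real.cos (2 * π * ⟪p, X i - y⟫_ℝ) :=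
    integral_const_mul _ _
  rw [he, eA, eB, eC, h1, h2s, h3] at hQ
  exact hQ

/-- **`∑_{i<j} cᵢcⱼ F(xᵢ - xⱼ) - ∑ᵢ cᵢ ∫ g F(xᵢ - ·) + ½∬ g g F ≥ -½ F(0) ∑ cᵢ²`** for the
positive-type kernel `F(z) = ∫ Φ(p) cos(2π⟨p, z⟩) dp`, `Φ ≥ 0` integrable, `F(0) = ∫ Φ` — the
inequality "`≥ -Nω(t)/2`" of [LiebSolovej2001, proof of Lemma 3.1] for such kernels (split the
double sum of `positiveType_points_nonneg` into its diagonal and twice its upper triangle).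
[cite: LiebSolovej2001, Lemma 3.1 (proof)] -/
theorem positiveType_points_ge {Φ : Space → ℝ} (hΦm : Measurable Φ) (hΦi : Integrable Φ)
    (hΦ0 : ∀ p, 0 ≤ Φ p) {N : ℕ} (c : Fin N → ℝ) (X : Fin N → Space) {g : Space → ℝ}
    (hgm : Measurable g) (hg : Integrable g) :
    -(1 / 2 * (∫ p, Φ p) * ∑ i, c i ^ 2) ≤
      (∑ i, ∑ j with i < j, c i * c j * ∫ p, Φ p * Real.cos (2 * π * ⟪p, X i - X j⟫_ℝ)) -
        (∑ i, c i * ∫ y, g y * ∫ p, Φ p * Real.cos (2 * π * ⟪p, X i - y⟫_ℝ)) +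
        1 / 2 * ∫ z : Space × Space, g z.1 * g z.2 *
          (∫ p, Φ p * Real.cos (2 * π * ⟪p, z.1 - z.2⟫_ℝ)) ∂(volume.prod volume) := by
  have h0 := positiveType_points_nonneg hΦm hΦi hΦ0 c X hgm hg
  set a : Fin N → Fin N → ℝ := fun i j => c i * c j * ∫ p, Φ p * Real.cos (2 * π * ⟪p, X i - X j⟫_ℝ)
    with ha
  have hsymm : ∀ i j, a i j = a j i := fun i j => by
    simp only [ha]
    have e : ∀ p : Space, Real.cos (2 * π * ⟪p, X i - X j⟫_ℝ) = Real.cos (2 * π * ⟪p, X j - X i⟫_ℝ) := by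
      intro p
      rw [← neg_sub (X j) (X i), inner_neg_right, mul_neg, Real.cos_neg]
    simp_rw [e]
    ring
  have hdiag : ∑ i, a i i = (∫ p, Φ p) * ∑ i, c i ^ 2 := by
    rw [Finset.mul_sum]
    refine Finset.sum_congr rfl fun i _ => ?_
    simp only [ha, sub_self, inner_zero_right, mul_zero, Real.cos_zero, mul_one]
    ring
  have hsplit := sum_sum_eq_diag_add_two_mul a hsymm
  rw [hsplit, hdiag] at h0
  linarith

end Literature.MathematicalPhysics.QuantumManyBody.Coulomb
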